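import Summits.FinalStateConjecture.FinalStateConjecture.Theorems.ClusterCompletenessOmegaLimitMultiKerrSketchDilatedSchwarzschild
import Summits.FinalStateConjecture.FinalStateConjecture.Theorems.EIHFluxBalanceInertialRecessionStubRechart3OwnTerm
import HarnessLib

/-!
# Crux `ClusterCompleteness.OmegaLimitMultiKerr` (stmt-FinalStateConjecture-17639), line `Sketch` v3 —
# the registered stub `stub_noHairUpToGauge` is FALSE AS TYPED

Part 2 of 2 (part 1: `…SketchDilatedSchwarzschild`, the witness `G = g_{1,0}(A·, A·)`). The stub
`stub_noHairUpToGauge` of the crux-strategist's child-2 skeleton (`Lines/split_child2_birth.lean`; v3 of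
`Lines/Sketch.lean`) says: a `C^{k+3}` Lorentzian Ricci-flat field `G` of bilinear forms on a closed-label
boosted Kerr exterior tube, `1/4`-anchored to `g_{M,a,Λ,c}`, tame on every `{r ≤ R'}`, invariant under the
translations by `Λe₀`, with null inner boundary, is isometric to SOME boosted Kerr–Schild exterior
`g_{M',a',Λ',c'}` through a gauge `θ` with `θ(x + s Λe₀) = θ(x) + s Λe₀` and `Λ'e₀ = Λe₀`.

**`stub_noHairUpToGauge_false : ¬ stub_noHairUpToGauge`.** At `k = 0`, `Λ = 1`, `c = 0`, `M = 1`,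
`a = 0` the time-dilated Schwarzschild form with `s = 1 − 1/(16(C_g + 1))` (`C_g` a uniform bound of
`‖g_{1,0}‖` on `{r ≥ 2}`) satisfies all seven hypotheses — smooth, Lorentzian, Ricci-flat, `1/4`-anchored
(`2|s−1| C_g ≤ 1/8`), tame (`exists_bound_iteratedFDeriv_postcomp_kerr`: `norm_iteratedFDeriv_clm_postcomp_le`
+ `exists_bound_iteratedFDeriv_ksPert` at orders `0…3`), stationary, null inner boundary — and the
conclusion fails (`dilated_no_unit_rate_gauge`): differentiating the commutation clause gives `dθ(e₀) = e₀`,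
so the isometry clause at `(e₀, e₀)` reads `s²(−1 + 2H₁(θx)) = −1 + 2H'(y)` for every `y` of the new
exterior; the left side is `≥ −s²`, whence `1 − s² ≤ 2H'(y) ≤ 2M'/r'(y)` for ALL `r'`, absurd far out.

Diagnosis for the planners (the lead reshapes the skeleton, v4): the stub lacks the NORMALISATION OF THE
STATIONARY KILLING FIELD at infinity (`G(Λe₀, Λe₀) → −1`) — equivalently its conclusion must allow a rate,
`∃ κ > 0, θ(x + s Λe₀) = θ(x) + κ s Λe₀` (here `θ = A⁻¹`, `κ = 1/s` works); and `stub_rebase`, which takes the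
no-hair statement at its own `k` as a HYPOTHESIS, is vacuously true as typed. The genuine content (black-hole
uniqueness without analyticity, Alexakis–Ionescu–Klainerman GAFA 20 (2010) in the perturbative regime, whose
statement does normalise the Killing field) is untouched.
-/

set_option linter.dupNamespace false
set_option maxSynthPendingDepth 3

noncomputable section

open scoped Topology Manifold ContDiff
open Filter Set Function TopologicalSpace Literature.Geometry.Lorentzian
open Summit.FinalStateConjecture.FinalStateConjecture.Theorems.SublinearIsFree.Rechart
  (exists_bound_iteratedFDeriv_ksPert norm_iteratedFDeriv_clm_postcomp_le)

namespace Summit.FinalStateConjecture.FinalStateConjecture.Theorems.ClusterCompleteness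

/-! ### Tame bounds and the rigidity of the Killing normalisation -/

-- deep operator-valued multilinear types: the instance path is slow
set_option synthInstance.maxHeartbeats 200000 in
/-- **Uniform `C³` bounds of `y ↦ L(g_{1,0}(y))` on `{r > 2}`** for a fixed operator `L` on the space of
bilinear forms (`norm_iteratedFDeriv_clm_postcomp_le` + the uniform bounds of `g_{1,0} − η`,
`exists_bound_iteratedFDeriv_ksPert`, every order). [folklore] -/
theorem exists_bound_iteratedFDeriv_postcomp_kerr
    (L : (E4 →L[ℝ] E4 →L[ℝ] ℝ) →L[ℝ] (E4 →L[ℝ] E4 →L[ℝ] ℝ)) :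
    ∃ C : ℝ, ∀ x : E4, 2 < Kerr.radius 0 x → ∀ j : ℕ, j ≤ 3 →
      ‖iteratedFDeriv ℝ j (fun y ↦ L (Kerr.bilin 1 0 y)) x‖ ≤ C := by
  obtain ⟨C₀, hC₀⟩ := exists_bound_iteratedFDeriv_ksPert 1 0 two_pos 0
  obtain ⟨C₁, hC₁⟩ := exists_bound_iteratedFDeriv_ksPert 1 0 two_pos 1
  obtain ⟨C₂, hC₂⟩ := exists_bound_iteratedFDeriv_ksPert 1 0 two_pos 2
  obtain ⟨C₃, hC₃⟩ := exists_bound_iteratedFDeriv_ksPert 1 0 two_pos 3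
  refine ⟨‖L‖ * (‖(Minkowski.bilin : E4 →L[ℝ] E4 →L[ℝ] ℝ)‖ + |C₀| + |C₁| + |C₂| + |C₃|),
    fun x hr2 j hj ↦ ?_⟩
  have hr : 0 < Kerr.radius 0 x := by linarith
  have hxU : x ∈ (Kerr.region 0 0 : Set E4) := by
    rw [SetLike.mem_coe, Kerr.mem_region, max_self]
    exact hr
  have hpost := norm_iteratedFDeriv_clm_postcomp_le L le_rfl (Kerr.region 0 0).isOpen hxU
    (fun y hy ↦ (Kerr.contDiffAt_bilin 1 0 (Kerr.radius_pos_of_mem_region hy)).contDiffWithinAt) j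
  have hbd : ‖iteratedFDeriv ℝ j (Kerr.bilin 1 0) x‖ ≤
      ‖(Minkowski.bilin : E4 →L[ℝ] E4 →L[ℝ] ℝ)‖ + |C₀| + |C₁| + |C₂| + |C₃| := by
    have hsplit : Kerr.bilin 1 0 = (fun _ : E4 ↦ (Minkowski.bilin : E4 →L[ℝ] E4 →L[ℝ] ℝ)) +
        fun y ↦ Kerr.bilin 1 0 y - Minkowski.bilin := by
      funext y
      exact (add_sub_cancel Minkowski.bilin (Kerr.bilin 1 0 y)).symm
    have hks : ContDiffAt ℝ j (fun y ↦ Kerr.bilin 1 0 y - Minkowski.bilin) x :=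
      Kerr.contDiffAt_ksPert (M := 1) hr
    rw [hsplit, iteratedFDeriv_add_apply contDiffAt_const hks]
    refine (norm_add_le _ _).trans ?_
    have hη : ∀ k : ℕ, 1 ≤ k →
        iteratedFDeriv ℝ k (fun _ : E4 ↦ (Minkowski.bilin : E4 →L[ℝ] E4 →L[ℝ] ℝ)) x = 0 :=
      fun k hk ↦ by
        rw [iteratedFDeriv_const_of_ne (𝕜 := ℝ) (E := E4) (by omega : k ≠ 0)
          (Minkowski.bilin : E4 →L[ℝ] E4 →L[ℝ] ℝ), Pi.zero_apply]
    interval_cases j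
    · simp only [norm_iteratedFDeriv_zero]
      have := hC₀ x hr2.le
      rw [norm_iteratedFDeriv_zero] at this
      linarith [le_abs_self C₀, abs_nonneg C₁, abs_nonneg C₂, abs_nonneg C₃]
    · rw [hη 1 le_rfl, norm_zero]
      linarith [hC₁ x hr2.le, le_abs_self C₁, abs_nonneg C₀, abs_nonneg C₂, abs_nonneg C₃,
        norm_nonneg (Minkowski.bilin : E4 →L[ℝ] E4 →L[ℝ] ℝ)]
    · rw [hη 2 (by norm_num), norm_zero]
      linarith [hC₂ x hr2.le, le_abs_self C₂, abs_nonneg C₀, abs_nonneg C₁, abs_nonneg C₃,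
        norm_nonneg (Minkowski.bilin : E4 →L[ℝ] E4 →L[ℝ] ℝ)]
    · rw [hη 3 (by norm_num), norm_zero]
      linarith [hC₃ x hr2.le, le_abs_self C₃, abs_nonneg C₀, abs_nonneg C₁, abs_nonneg C₂,
        norm_nonneg (Minkowski.bilin : E4 →L[ℝ] E4 →L[ℝ] ℝ)]
  exact hpost.trans (by gcongr)

section Rigidity

variable {s : ℝ} {A : E4 →L[ℝ] E4}
  (hA : ∀ w : E4, A w = w + ((s - 1) * w 0) • E4.basisVector 0)
  {G : E4 → E4 →L[ℝ] E4 →L[ℝ] ℝ} (hG : ∀ y v w, G y v w = Kerr.bilin 1 0 y (A v) (A w))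

include hA hG in
/-- **No unit-rate gauge onto the dilated Schwarzschild form.** For `0 < s < 1` there is no
differentiable `θ` mapping a boosted Kerr–Schild exterior `{r' > r₊(M', a')}` (any `M' > 0`, `a'`, `Λ'`
with `Λ'e₀ = e₀`, `c'`) onto `{r > 2}`, commuting with the translations by `e₀`, and pulling `G` back to
`g_{M',a',Λ',c'}`: differentiating the commutation gives `dθ(e₀) = e₀`, so the isometry clause at
`(e₀, e₀)` reads `s² (−1 + 2H₁(θx)) = −1 + 2H'` with `H₁ ≥ 0` and `H' ≤ M'/r' → 0` far out, i.e.
`1 − s² ≤ 2M'/r'` for ALL `r'`, absurd. [folklore] -/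
theorem dilated_no_unit_rate_gauge (hs0 : 0 < s) (hs1 : s < 1) {M' a' : ℝ} {Λ' : lorentzGroup}
    {c' : E4} {θ : E4 → E4} (hM' : 0 < M')
    (hΛ' : (Λ' : E4 ≃L[ℝ] E4) (E4.basisVector 0) = E4.basisVector 0)
    (hθ : DifferentiableOn ℝ θ (boostedKerrExterior Λ' c' M' a' : Set E4))
    (hcomm : ∀ x ∈ (boostedKerrExterior Λ' c' M' a' : Set E4), ∀ t : ℝ,
      θ (x + t • E4.basisVector 0) = θ x + t • E4.basisVector 0)
    (hiso : ∀ x ∈ (boostedKerrExterior Λ' c' M' a' : Set E4), ∀ v w : E4,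
      G (θ x) (fderiv ℝ θ x v) (fderiv ℝ θ x w) = boostedKerrBilin Λ' c' M' a' x v w) : False := by
  have h1s2 : 0 < 1 - s ^ 2 := by nlinarith
  have hΛ's : (Λ' : E4 ≃L[ℝ] E4).symm (E4.basisVector 0) = E4.basisVector 0 := by
    rw [ContinuousLinearEquiv.symm_apply_eq]
    exact hΛ'.symm
  -- a far point `y₀` of the new exterior and its lab position `x₀`
  obtain ⟨K, hK⟩ : ∃ K : ℝ, K = 2 * M' / (1 - s ^ 2) + 2 * M' + 1 := ⟨_, rfl⟩
  have hK1 : 0 ≤ 2 * M' / (1 - s ^ 2) := div_nonneg (by linarith) h1s2.le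
  have hK0 : 0 < K := by rw [hK]; linarith
  obtain ⟨R, hR⟩ : ∃ R : ℝ, R = K + |a'| + 1 := ⟨_, rfl⟩
  have hRpos : 0 < R := by rw [hR]; positivity
  obtain ⟨y₀, hy₀⟩ : ∃ y₀ : E4, y₀ = E4.ofTimeSpace 0 (R • EuclideanSpace.single (0 : Fin 3) (1 : ℝ)) :=
    ⟨_, rfl⟩
  have hy₀n : E4.spatialNorm y₀ = R := by
    rw [hy₀, E4.spatialNorm_ofTimeSpace, norm_smul, PiLp.norm_single, norm_one, mul_one,
      Real.norm_eq_abs, abs_of_pos hRpos]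
  have hrad : K < Kerr.radius a' y₀ := by
    have h1 := Kerr.spatialNorm_sq_sub_sq_le_radius_sq a' y₀
    rw [hy₀n] at h1
    have h2 : K ^ 2 < R ^ 2 - a' ^ 2 := by
      rw [hR]
      nlinarith [abs_nonneg a', sq_abs a']
    nlinarith [Kerr.radius_nonneg a' y₀]
  have hrpos : 0 < Kerr.radius a' y₀ := hK0.trans hrad
  obtain ⟨x₀, hx₀⟩ : ∃ x₀ : E4, x₀ = (Λ' : E4 ≃L[ℝ] E4) y₀ + c' := ⟨_, rfl⟩
  have hpx₀ : poincareInv Λ' c' x₀ = y₀ := by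
    rw [poincareInv, hx₀, add_sub_cancel_right, ContinuousLinearEquiv.symm_apply_apply]
  have hx₀mem : x₀ ∈ (boostedKerrExterior Λ' c' M' a' : Set E4) := by
    rw [SetLike.mem_coe, mem_boostedKerrExterior, hpx₀, Kerr.mem_exterior]
    refine max_lt ?_ hrpos
    have hrp : Kerr.rPlus M' a' ≤ 2 * M' := by
      unfold Kerr.rPlus
      have h1 : √(M' ^ 2 - a' ^ 2) ≤ √(M' ^ 2) := Real.sqrt_le_sqrt (by nlinarith [sq_nonneg a'])
      rw [Real.sqrt_sq hM'.le] at h1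
      linarith
    calc Kerr.rPlus M' a' ≤ 2 * M' := hrp
      _ < K := by rw [hK]; linarith
      _ < Kerr.radius a' y₀ := hrad
  -- `dθ(e₀) = e₀` at `x₀`
  have hopen : IsOpen (boostedKerrExterior Λ' c' M' a' : Set E4) :=
    (boostedKerrExterior Λ' c' M' a').isOpen
  have hdiff : DifferentiableAt ℝ θ x₀ := (hθ x₀ hx₀mem).differentiableAt (hopen.mem_nhds hx₀mem)
  have hline : ∀ p : E4, HasDerivAt (fun t : ℝ ↦ p + t • E4.basisVector 0) (E4.basisVector 0) 0 :=
    fun p ↦ by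
      simpa using ((hasDerivAt_id (0 : ℝ)).smul_const (E4.basisVector 0)).const_add p
  have hdθ : fderiv ℝ θ x₀ (E4.basisVector 0) = E4.basisVector 0 := by
    have hc1 : HasDerivAt (fun t : ℝ ↦ θ (x₀ + t • E4.basisVector 0))
        (fderiv ℝ θ x₀ (E4.basisVector 0)) 0 := by
      have hf : HasFDerivAt θ (fderiv ℝ θ x₀) (x₀ + (0 : ℝ) • E4.basisVector 0) := by
        rw [zero_smul, add_zero]
        exact hdiff.hasFDerivAt
      exact hf.comp_hasDerivAt (0 : ℝ) (hline x₀)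
    have hc2 : HasDerivAt (fun t : ℝ ↦ θ (x₀ + t • E4.basisVector 0)) (E4.basisVector 0) 0 := by
      have : (fun t : ℝ ↦ θ (x₀ + t • E4.basisVector 0)) = fun t ↦ θ x₀ + t • E4.basisVector 0 :=
        funext fun t ↦ hcomm x₀ hx₀mem t
      rw [this]
      exact hline (θ x₀)
    exact hc1.unique hc2
  -- the isometry clause at `(e₀, e₀)`
  have hkey := hiso x₀ hx₀mem (E4.basisVector 0) (E4.basisVector 0)
  rw [hdθ, hG, timeDilation_basisVector_zero hA] at hkey
  simp only [map_smul, FunLike.coe_smul, Pi.smul_apply, smul_eq_mul] at hkey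
  rw [kerr_bilin_basisVector_zero, boostedKerrBilin_apply, hpx₀, hΛ's, kerr_bilin_basisVector_zero]
    at hkey
  have hH1 : 0 ≤ Kerr.scalarH 1 0 (θ x₀) := Kerr.scalarH_nonneg zero_le_one 0 _
  have hH' : Kerr.scalarH M' a' y₀ ≤ M' / Kerr.radius a' y₀ := Kerr.scalarH_le_div hM'.le a' hrpos
  have h3 : 1 - s ^ 2 ≤ 2 * M' / Kerr.radius a' y₀ := by
    rw [mul_div_assoc]
    nlinarith [hkey, hH1, hH', sq_nonneg s]
  have h4 : (1 - s ^ 2) * Kerr.radius a' y₀ ≤ 2 * M' := (le_div_iff₀ hrpos).1 h3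
  have h5 : Kerr.radius a' y₀ ≤ 2 * M' / (1 - s ^ 2) := by
    rw [le_div_iff₀ h1s2]
    linarith
  have h6 : 2 * M' / (1 - s ^ 2) < K := by rw [hK]; linarith
  linarith

end Rigidity

/-! ### The refutation -/

/-- **`stub_noHairUpToGauge` is false as typed.** The time-dilated Schwarzschild form
`G(x)(v, w) = g_{1,0}(x)(A v, A w)`, `A = diag(s, 1, 1, 1)`, `s < 1` close to `1`, on the exterior
`{r > 2}` (`Λ = 1`, `c = 0`, `M = 1`, `a = 0`) satisfies every hypothesis of the stub at `k = 0`
(stationary, Ricci-flat, Lorentzian, `1/4`-anchored, tame, null inner boundary) but is isometric to no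
boosted Kerr–Schild exterior through a gauge commuting with the UNIT-RATE translations by `e₀`: such a
gauge would give `s² (−1 + 2H₁) = −1 + 2H'` along the new exterior, impossible far out where `H' → 0`.
The stationary Killing field of `G` is `e₀` with `G(e₀, e₀) → −s² ≠ −1` at infinity: the stub lacks the
normalisation of the Killing field (equivalently, a rate in the commutation clause). [folklore] -/
theorem stub_noHairUpToGauge_false : ¬ (∀ k : ℕ, ∀ (Λ : lorentzGroup) (c : E4) (M a : ℝ), 0 < M → |a| ≤ M → ∀ (G : E4 → E4 →L[ℝ] E4 →L[ℝ] ℝ), ContDiffOn ℝ (k + 3) G (boostedKerrExterior Λ c M a : Set E4) → (∀ x ∈ (boostedKerrExterior Λ c M a : Set E4), (G x).IsInvertible ∧ (∀ v w : E4, G x v w = G x w v) ∧ ∃ v : E4, G x v v < 0 ∧ ∀ w : E4, G x v w = 0 → w ≠ 0 → 0 < G x w w) → (∀ x ∈ (boostedKerrExterior Λ c M a : Set E4), MetricCoord.ricAt G x = 0) → (∀ x ∈ (boostedKerrExterior Λ c M a : Set E4), ‖G x - boostedKerrBilin Λ c M a x‖ ≤ 1 / 4) → (∀ R' : ℝ,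 ∃ C : ℝ, ∀ x ∈ (boostedKerrExterior Λ c M a : Set E4), Kerr.radius a (poincareInv Λ c x) ≤ R' → ∀ j : ℕ, j ≤ k + 3 → ‖iteratedFDeriv ℝ j G x‖ ≤ C) → (∀ x ∈ (boostedKerrExterior Λ c M a : Set E4), ∀ s : ℝ, G (x + s • ((Λ : E4 ≃L[ℝ] E4) (E4.basisVector 0))) = G x) → (∀ ε : ℝ, 0 < ε → ∃ δ : ℝ, 0 < δ ∧ ∀ x ∈ (boostedKerrExterior Λ c M a : Set E4), Kerr.radius a (poincareInv Λ c x) < Kerr.rPlus M a + δ → |((fderiv ℝ (fun y ↦ Kerr.radius a (poincareInv Λ c y)) x) (MetricCoord.sharpAt G x (fderiv ℝ (fun y ↦ Kerr.radius a (poincareInv Λ c y)) x)))| ≤ ε) → ∃ (M' a' : ℝ) (Λ' : lorentzGroup) (c' : E4) (θ : E4 → E4), 0 < M' ∧ |a'| ≤ M' ∧ (Λ' : E4 ≃L[ℝ] E4) (E4.basisVector 0) = ((Λ : E4 ≃L[ℝ] E4) (E4.basisVector 0)) ∧ ContDiffOn ℝ (k + 3) θ (boostedKerrExterior Λ' c'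 M' a' : Set E4) ∧ Set.InjOn θ (boostedKerrExterior Λ' c' M' a' : Set E4) ∧ θ '' (boostedKerrExterior Λ' c' M' a' : Set E4) = (boostedKerrExterior Λ c M a : Set E4) ∧ (∀ x ∈ (boostedKerrExterior Λ' c' M' a' : Set E4), ∀ s : ℝ, θ (x + s • ((Λ : E4 ≃L[ℝ] E4) (E4.basisVector 0))) = θ x + s • ((Λ : E4 ≃L[ℝ] E4) (E4.basisVector 0))) ∧ ∀ x ∈ (boostedKerrExterior Λ' c' M' a' : Set E4), ∀ v w : E4, G (θ x) (fderiv ℝ θ x v) (fderiv ℝ θ x w) = boostedKerrBilin Λ' c' M' a' x v w) := by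
  intro h
  -- (0) uniform bounds of `g_{1,0} − η` on `{r ≥ 2}`, every order
  obtain ⟨C₀, hC₀⟩ := exists_bound_iteratedFDeriv_ksPert 1 0 two_pos 0
  set Cg : ℝ := ‖(Minkowski.bilin : E4 →L[ℝ] E4 →L[ℝ] ℝ)‖ + |C₀| with hCg
  have hCg0 : 0 ≤ Cg := by positivity
  have hg_le : ∀ x : E4, 2 ≤ Kerr.radius 0 x → ‖Kerr.bilin 1 0 x‖ ≤ Cg := by
    intro x hx
    have h0 := hC₀ x hx
    rw [norm_iteratedFDeriv_zero] at h0
    calc ‖Kerr.bilin 1 0 x‖ = ‖(Kerr.bilin 1 0 x - Minkowski.bilin) + Minkowski.bilin‖ := by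
          rw [sub_add_cancel]
      _ ≤ ‖Kerr.bilin 1 0 x - Minkowski.bilin‖ + ‖(Minkowski.bilin : E4 →L[ℝ] E4 →L[ℝ] ℝ)‖ :=
          norm_add_le _ _
      _ ≤ Cg := by rw [hCg]; linarith [le_abs_self C₀]
  -- (1) the dilation parameter `s = 1 − 1/(16 (Cg + 1))`
  set ε₀ : ℝ := 1 / (16 * (Cg + 1)) with hε₀
  have hε₀pos : 0 < ε₀ := by positivity
  have hε₀le : ε₀ ≤ 1 / 16 := by
    rw [hε₀]
    exact div_le_div_of_nonneg_left zero_le_one (by norm_num) (by nlinarith)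
  set s : ℝ := 1 - ε₀ with hs_def
  have hs0 : 0 < s := by rw [hs_def]; linarith
  have hs1 : s < 1 := by rw [hs_def]; linarith
  have hsne : s ≠ 0 := hs0.ne'
  have hsabs : |s - 1| = ε₀ := by
    rw [hs_def, show (1 : ℝ) - ε₀ - 1 = -ε₀ by ring, abs_neg, abs_of_pos hε₀pos]
  -- (2) the maps `A = diag(s,1,1,1)`, `B = A⁻¹`, the post-composition `L`, and `G`
  set A : E4 →L[ℝ] E4 :=
    ContinuousLinearMap.id ℝ E4 + (s - 1) • (E4.dx 0).smulRight (E4.basisVector 0) with hA_def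
  set B : E4 →L[ℝ] E4 :=
    ContinuousLinearMap.id ℝ E4 + (s⁻¹ - 1) • (E4.dx 0).smulRight (E4.basisVector 0) with hB_def
  have hA : ∀ w : E4, A w = w + ((s - 1) * w 0) • E4.basisVector 0 := fun w ↦ by
    simp only [hA_def, add_apply, ContinuousLinearMap.id_apply,
      FunLike.coe_smul, Pi.smul_apply, ContinuousLinearMap.smulRight_apply, smul_smul]
    rfl
  have hB : ∀ w : E4, B w = w + ((s⁻¹ - 1) * w 0) • E4.basisVector 0 := fun w ↦ by
    simp only [hB_def, add_apply, ContinuousLinearMap.id_apply,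
      FunLike.coe_smul, Pi.smul_apply, ContinuousLinearMap.smulRight_apply, smul_smul]
    rfl
  set L : (E4 →L[ℝ] E4 →L[ℝ] ℝ) →L[ℝ] (E4 →L[ℝ] E4 →L[ℝ] ℝ) :=
    ((ContinuousLinearMap.compL ℝ E4 (E4 →L[ℝ] ℝ) (E4 →L[ℝ] ℝ))
      (ContinuousLinearMap.precomp ℝ A)).comp (ContinuousLinearMap.precomp (E4 →L[ℝ] ℝ) A) with hL_def
  set G : E4 → E4 →L[ℝ] E4 →L[ℝ] ℝ := fun y ↦ L (Kerr.bilin 1 0 y) with hG_def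
  have hG : ∀ y v w, G y v w = Kerr.bilin 1 0 y (A v) (A w) := fun y v w ↦ rfl
  -- (3) the exterior `{r > 2}` and the unit time axis
  have h1e : ((1 : lorentzGroup) : E4 ≃L[ℝ] E4) (E4.basisVector 0) = E4.basisVector 0 := rfl
  have hExt : ∀ x : E4, x ∈ (boostedKerrExterior 1 0 1 0 : Set E4) ↔ 2 < Kerr.radius 0 x := by
    intro x
    rw [SetLike.mem_coe, mem_boostedKerrExterior, poincareInv_one_zero, Kerr.mem_exterior,
      Kerr.rPlus_zero_right zero_le_one, mul_one, max_eq_left zero_le_two]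
  have hfun : (fun y ↦ Kerr.radius 0 (poincareInv 1 0 y)) = Kerr.radius 0 :=
    funext fun y ↦ by rw [poincareInv_one_zero]
  have hmain := h 0 1 0 1 0 one_pos (by norm_num) G
  refine absurd (hmain ?_ ?_ ?_ ?_ ?_ ?_ ?_) ?_
  · -- H1: smoothness
    intro x hx
    have hr : 0 < Kerr.radius 0 x := by linarith [(hExt x).1 hx]
    exact (L.contDiff.contDiffAt.comp x (Kerr.contDiffAt_bilin 1 0 hr)).contDiffWithinAt
  · -- H2: Lorentzian, symmetric, invertible
    intro x hx
    have hr : 0 < Kerr.radius 0 x := by linarith [(hExt x).1 hx]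
    exact ⟨isInvertible_dilated hA hB hG hsne hr, fun v w ↦ by rw [hG, hG, Kerr.bilin_symm],
      dilated_signature hA hB hG hsne hr⟩
  · -- H3: Ricci-flat
    intro x hx
    have hr : 0 < Kerr.radius 0 x := by linarith [(hExt x).1 hx]
    exact ricAt_dilated hA hB hG hsne hr
  · -- H4: `C⁰` anchor
    intro x hx
    have hr2 : 2 < Kerr.radius 0 x := (hExt x).1 hx
    rw [boostedKerrBilin_one_zero]
    calc ‖G x - Kerr.bilin 1 0 x‖ ≤ 2 * |s - 1| * ‖Kerr.bilin 1 0 x‖ :=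
          norm_dilated_sub_le hA hG hs0.le hs1.le x
      _ ≤ 2 * |s - 1| * Cg := by gcongr; exact hg_le x hr2.le
      _ = 2 * Cg / (16 * (Cg + 1)) := by rw [hsabs, hε₀]; ring
      _ ≤ 1 / 4 := by
          rw [div_le_div_iff₀ (by positivity) (by norm_num)]
          nlinarith
  · -- H5: tame bounds, every `R'`
    intro R'
    obtain ⟨C, hC⟩ := exists_bound_iteratedFDeriv_postcomp_kerr L
    exact ⟨C, fun x hx _ j hj ↦ hC x ((hExt x).1 hx) j (by simpa using hj)⟩
  · -- H6: stationarity
    intro x _ t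
    rw [h1e]
    ext v w
    rw [hG, hG, Kerr.bilin_add_smul_basisVector_zero]
  · -- H7: null inner boundary
    intro ε hε
    refine ⟨ε, hε, fun x hx hlt ↦ ?_⟩
    rw [poincareInv_one_zero, Kerr.rPlus_zero_right zero_le_one] at hlt
    have hr2 : 2 < Kerr.radius 0 x := (hExt x).1 hx
    have hr : 0 < Kerr.radius 0 x := by linarith
    rw [hfun, fderiv_radius_sharpAt_dilated hA hB hG hsne hr]
    have heq : 1 - 2 / Kerr.radius 0 x = (Kerr.radius 0 x - 2) / Kerr.radius 0 x := by
      field_simp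
    rw [heq, abs_of_nonneg (div_nonneg (by linarith) hr.le), div_le_iff₀ hr]
    nlinarith
  · -- the conclusion fails
    clear hmain
    rintro ⟨M', a', Λ', c', θ, hM', -, hΛ', hθ, -, -, hcomm, hiso⟩
    clear h
    rw [h1e] at hΛ' hcomm
    exact dilated_no_unit_rate_gauge hA hG hs0 hs1 hM' hΛ' (hθ.differentiableOn (by norm_num))
      hcomm hiso

end Summit.FinalStateConjecture.FinalStateConjecture.Theorems.ClusterCompleteness

end
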